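import Summits.QuantumFields.YangMills.Theorems.BalabanLadderNTOnePointFloor
import HarnessLib

/-!
# Crux `NT` (stmt-QuantumFields-19353): the zero-momentum two-point function has a FLOOR on every coupling window
# `[β, Aβ(1 + log β)]`, uniformly in the volume — hypothesis-free

Fleet lead prover of crux `NT` (unit `ym-spine-19353-p1`, g9).  The FLOOR twin of g8's
`CouplingSumRule.exists_integral_sum_torusCov_dens_le` / `exists_sum_torusCov_dens_le_window` (the zero-momentum
susceptibility `χ_L(γ; x) := Σ_{z ∈ box L} Cov_{T,γ}(A_x, A_z) = ∂_γ E_{T,γ}[A_x] ≥ 0` is β-integrable and obeys the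
`β⁻²` law from ABOVE on every window `[β, 2β]`).  Feeding the exact sum rule (FTC, `integral_sum_torusCov_dens_eq`) with
the ONE-POINT FLOOR `c₁/β ≤ 6N − E_{T,β}[A_x]` of `Theorems/BalabanLadderNTOnePointFloor` (equipartition, this seat) at the
lower end and the tree's chessboard ceiling `6N − E_{T,β'}[A_x] ≤ 6K(1 + log β')/β'` at the upper end `β' = Aβ(1 + log β)`:

* `exists_integral_sum_torusCov_dens_ge` — `∫_β^{Aβ(1+log β)} χ_L(γ; x) dγ ≥ c/β` for all `β ≥ β₀`, all odd tori `2L+1 ≥ 5`,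
  all sites (`c, A, β₀` depend on `(G, r)` only);
* **`exists_sum_torusCov_dens_ge_window`** — hence some `γ ∈ [β, Aβ(1 + log β)]` has
  `χ_L(γ; x) ≥ c'/(β²(1 + log β))`: together with g8's ceiling, the perturbative `β⁻²` law AT ZERO LATTICE MOMENTUM holds
  FROM BOTH SIDES up to logarithms on a set of couplings meeting every such window, for every compact gauge group of positive
  dimension (every compact simple `G`: `…_of_simple`), uniformly in `L`, without any expansion.

HONEST FRAMING.  `k = 0` (total-action variance per site ≥ c'/(β²(1+log β)) somewhere in every window) is perturbatively
visible; NT's β-UNIFORM floor `ε ≤ Q2_{β,L,a(β)}(θv, v)` lives at lattice momenta `|k| ≍ a(β) → 0` and is dimensional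
transmutation — not claimed.  No pointwise-in-β statement (none is expected softly: first-order bulk transitions make `χ_L`
volume-divergent at isolated couplings), nothing of the seam or the gap; not Clay.
Refs: Montvay–Münster 1994 §3.2; Chatterjee arXiv:1602.01222 Thm. 2.1; Fröhlich–Israel–Lieb–Simon 1978 (chessboard).
-/

set_option autoImplicit false

noncomputable section

open MeasureTheory Filter Set
open scoped BigOperators
open Literature.MathematicalPhysics.QuantumLattice
open Literature.MathematicalPhysics.QuantumFieldTheory hiding ZdEdge
open Literature.Probability.LatticeModels (box)
open Summit.QuantumFields.YangMills.Theorems.FreeEnergyLogCoefficient (dimE)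
open Summit.QuantumFields.YangMills.Cruxes.OSLegsFromFemtoAndGap.DlrCollarTransfer (torusE dens)
open Summit.QuantumFields.YangMills.Cruxes.NT.CouplingSumRule (integral_sum_torusCov_dens_eq continuous_sum_torusCov_dens
  exists_six_mul_sub_torusE_dens_le sum_torusCov_dens_nonneg)

namespace Summit.QuantumFields.YangMills.Cruxes.NT.LinkEquipartition

section Window

variable (G : Type) [Group G] [TopologicalSpace G] [IsTopologicalGroup G] [CompactSpace G]
  [MeasurableSpace G] [BorelSpace G] (r : LatticeRep G)

/-- Elementary: for `M ≥ 1`, `(1 + log (M²))/M² ≤ 3/M` (`log M ≤ M − 1`). [folklore] -/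
theorem one_add_log_sq_div_sq_le {M : ℝ} (hM : 1 ≤ M) : (1 + Real.log (M ^ 2)) / M ^ 2 ≤ 3 / M := by
  have hM0 : 0 < M := lt_of_lt_of_le one_pos hM
  have hlog : Real.log M ≤ M - 1 := Real.log_le_sub_one_of_pos hM0
  rw [Real.log_pow, div_le_div_iff₀ (by positivity) hM0]
  push_cast
  nlinarith

/-- Elementary: for `A, β ≥ 1`, `1 + log (A β (1 + log β)) ≤ 2 (1 + log A) (1 + log β)`. [folklore] -/
theorem one_add_log_window_le {A β : ℝ} (hA : 1 ≤ A) (hβ : 1 ≤ β) :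
    1 + Real.log (A * β * (1 + Real.log β)) ≤ 2 * (1 + Real.log A) * (1 + Real.log β) := by
  have hA0 : 0 < A := lt_of_lt_of_le one_pos hA
  have hβ0 : 0 < β := lt_of_lt_of_le one_pos hβ
  have hlA : 0 ≤ Real.log A := Real.log_nonneg hA
  have hlβ : 0 ≤ Real.log β := Real.log_nonneg hβ
  have h1 : 0 < 1 + Real.log β := by linarith
  rw [Real.log_mul (by positivity) h1.ne', Real.log_mul hA0.ne' hβ0.ne']
  have h2 : Real.log (1 + Real.log β) ≤ Real.log β := by
    have := Real.log_le_sub_one_of_pos h1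
    have h3 : Real.log (1 + Real.log β) ≤ (1 + Real.log β) - 1 := this
    -- `log(1 + log β) ≤ log β` ⟸ `1 + log β ≤ β` ⟸ `log β ≤ β − 1`
    exact Real.log_le_log h1 (by linarith [Real.log_le_sub_one_of_pos hβ0])
  nlinarith

/-- **THE INTEGRATED ZERO-MOMENTUM FLOOR.**  There are `c > 0`, `A ≥ 1`, `β₀ ≥ 1` (depending on `(G, r)` only) such that
for every odd torus `2L+1 ≥ 5`, every `β ≥ β₀` and every site `x`:
`c/β ≤ ∫_β^{Aβ(1 + log β)} Σ_{z ∈ box L} Cov_{T,γ}(A_x, A_z) dγ` — the equipartition one-point floor at `β` minus the chessboard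
one-point ceiling at `Aβ(1 + log β)`, through the exact sum rule. [folklore] -/
theorem exists_integral_sum_torusCov_dens_ge (hD : 0 < dimE r.ρ) :
    ∃ c A β₀ : ℝ, 0 < c ∧ 1 ≤ A ∧ 1 ≤ β₀ ∧ ∀ (L : ℕ), 2 ≤ L → ∀ β : ℝ, β₀ ≤ β → ∀ x : Fin 4 → ℤ,
      c / β ≤ ∫ γ in β..(A * β * (1 + Real.log β)), ∑ z ∈ box 4 L,
        (torusE G r γ L (fun U => dens G r x U * dens G r z U) - torusE G r γ L (dens G r x) * torusE G r γ L (dens G r z)) := by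
  obtain ⟨c₁, β₁, hc₁, hβ₁, hfloor⟩ := exists_six_mul_sub_torusE_dens_ge G r hD
  obtain ⟨K, hK0, hceil⟩ := exists_six_mul_sub_torusE_dens_le G r
  -- the window length factor
  set M : ℝ := max 1 (72 * K / c₁) with hM
  have hM1 : 1 ≤ M := le_max_left _ _
  have hM0 : 0 < M := lt_of_lt_of_le one_pos hM1
  have hMK : 72 * K / c₁ ≤ M := le_max_right _ _
  set A : ℝ := M ^ 2 with hA
  have hA1 : 1 ≤ A := by rw [hA]; nlinarith
  refine ⟨c₁ / 2, A, max β₁ 1, by positivity, hA1, le_max_right _ _, fun L hL β hβ x => ?_⟩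
  have hββ₁ : β₁ ≤ β := (le_max_left _ _).trans hβ
  have hβ1 : 1 ≤ β := (le_max_right _ _).trans hβ
  have hβ0 : 0 < β := lt_of_lt_of_le one_pos hβ1
  have hlβ : 0 ≤ Real.log β := Real.log_nonneg hβ1
  set β' : ℝ := A * β * (1 + Real.log β) with hβ'
  have hβ'ge : β ≤ β' := by
    rw [hβ']
    calc β = 1 * β * 1 := by ring
      _ ≤ A * β * (1 + Real.log β) := by gcongr; linarith
  have hβ'1 : 1 ≤ β' := hβ1.trans hβ'ge
  have hβ'0 : 0 < β' := lt_of_lt_of_le one_pos hβ'1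
  -- FTC: the integral is the increment of the one-point function
  rw [integral_sum_torusCov_dens_eq]
  have h1 := hfloor β hββ₁ L hL x
  have h2 := hceil L (by omega) β' hβ'1 x
  -- the ceiling at `β'` is at most half the floor at `β`
  have h3 : 6 * K * (1 + Real.log β') / β' ≤ c₁ / (2 * β) := by
    have h1lβ : 0 < 1 + Real.log β := by linarith
    have hA0 : 0 < A := lt_of_lt_of_le one_pos hA1
    have hlA0 : 0 ≤ Real.log A := Real.log_nonneg hA1
    have hw := one_add_log_window_le hA1 hβ1
    have hlA : (1 + Real.log A) / A ≤ 3 / M := by rw [hA]; exact one_add_log_sq_div_sq_le hM1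
    have hlA' : 1 + Real.log A ≤ 3 * A / M := by
      rw [div_le_div_iff₀ hA0 hM0] at hlA
      rw [le_div_iff₀ hM0]
      linarith
    have hK72 : 72 * K ≤ c₁ * M := by
      have := (div_le_iff₀ hc₁).1 hMK
      linarith
    have hw' : 6 * K * (1 + Real.log β') ≤ 12 * K * ((1 + Real.log A) * (1 + Real.log β)) := by
      have := mul_le_mul_of_nonneg_left hw (by positivity : (0 : ℝ) ≤ 6 * K)
      linarith
    have hPos : 0 ≤ A * β * (1 + Real.log β) := mul_nonneg (mul_nonneg hA0.le hβ0.le) h1lβ.le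
    rw [div_le_div_iff₀ hβ'0 (by positivity)]
    calc 6 * K * (1 + Real.log β') * (2 * β)
        ≤ 12 * K * ((1 + Real.log A) * (1 + Real.log β)) * (2 * β) := mul_le_mul_of_nonneg_right hw' (by positivity)
      _ = 24 * K * β * (1 + Real.log β) * (1 + Real.log A) := by ring
      _ ≤ 24 * K * β * (1 + Real.log β) * (3 * A / M) :=
          mul_le_mul_of_nonneg_left hlA' (mul_nonneg (by positivity) h1lβ.le)
      _ = 72 * K * (A * β * (1 + Real.log β)) / M := by ring
      _ ≤ c₁ * M * (A * β * (1 + Real.log β)) / M :=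
          div_le_div_of_nonneg_right (mul_le_mul_of_nonneg_right hK72 hPos) hM0.le
      _ = c₁ * (A * β * (1 + Real.log β)) := by field_simp
      _ = c₁ * β' := by rw [hβ']
  have h4 : 6 * (r.N : ℝ) - torusE G r β' L (dens G r x) ≤ c₁ / (2 * β) := h2.trans h3
  have h5 : c₁ / 2 / β = c₁ / β - c₁ / (2 * β) := by field_simp; ring
  linarith

/-- **THE ZERO-MOMENTUM TWO-POINT FLOOR ON EVERY COUPLING WINDOW, uniformly in the volume.**  There are `c > 0`,
`A ≥ 1`, `β₀ ≥ 1` such that for every odd torus `2L+1 ≥ 5`, every `β ≥ β₀` and every site `x` some coupling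
`γ ∈ [β, Aβ(1 + log β)]` has `c/(β²(1 + log β)) ≤ Σ_{z ∈ box L} Cov_{T,γ}(A_x, A_z)` (the maximum of the continuous
susceptibility over the window is at least its mean). [folklore] -/
theorem exists_sum_torusCov_dens_ge_window (hD : 0 < dimE r.ρ) :
    ∃ c A β₀ : ℝ, 0 < c ∧ 1 ≤ A ∧ 1 ≤ β₀ ∧ ∀ (L : ℕ), 2 ≤ L → ∀ β : ℝ, β₀ ≤ β → ∀ x : Fin 4 → ℤ,
      ∃ γ ∈ Set.Icc β (A * β * (1 + Real.log β)),
        c / (β ^ 2 * (1 + Real.log β)) ≤ ∑ z ∈ box 4 L,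
          (torusE G r γ L (fun U => dens G r x U * dens G r z U) - torusE G r γ L (dens G r x) * torusE G r γ L (dens G r z)) := by
  obtain ⟨c, A, β₀, hc, hA1, hβ₀1, h⟩ := exists_integral_sum_torusCov_dens_ge G r hD
  refine ⟨c / A, A, β₀, by positivity, hA1, hβ₀1, fun L hL β hβ x => ?_⟩
  have hA0 : 0 < A := lt_of_lt_of_le one_pos hA1
  have hβ1 : 1 ≤ β := hβ₀1.trans hβ
  have hβ0 : 0 < β := lt_of_lt_of_le one_pos hβ1
  have hlβ : 0 ≤ Real.log β := Real.log_nonneg hβ1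
  have h1lβ : 0 < 1 + Real.log β := by linarith
  set β' : ℝ := A * β * (1 + Real.log β) with hβ'
  have hβ'ge : β ≤ β' := by
    rw [hβ']
    calc β = 1 * β * 1 := by ring
      _ ≤ A * β * (1 + Real.log β) := by gcongr; linarith
  set χ : ℝ → ℝ := fun γ => ∑ z ∈ box 4 L,
    (torusE G r γ L (fun U => dens G r x U * dens G r z U) - torusE G r γ L (dens G r x) * torusE G r γ L (dens G r z)) with hχ
  have hcont : Continuous χ := continuous_sum_torusCov_dens G r L x
  obtain ⟨γ₀, hγ₀, hmax⟩ := isCompact_Icc.exists_isMaxOn (Set.nonempty_Icc.2 hβ'ge) hcont.continuousOn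
  refine ⟨γ₀, hγ₀, ?_⟩
  have hint := h L hL β hβ x
  -- the integral is at most the window length times the maximum
  have hle : ∫ γ in β..β', χ γ ≤ (β' - β) * χ γ₀ := by
    calc ∫ γ in β..β', χ γ ≤ ∫ _γ in β..β', χ γ₀ :=
          intervalIntegral.integral_mono_on hβ'ge (hcont.intervalIntegrable _ _) (continuous_const.intervalIntegrable _ _)
            fun γ hγ => hmax hγ
      _ = (β' - β) * χ γ₀ := by rw [intervalIntegral.integral_const, smul_eq_mul]
  have hlen : β' - β ≤ β' := by linarith
  have hβ'le : β' ≤ A * β * (1 + Real.log β) := le_rfl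
  have hχ0 : 0 ≤ χ γ₀ := sum_torusCov_dens_nonneg G r γ₀ L x
  have hkey : c / β ≤ β' * χ γ₀ :=
    hint.trans (hle.trans (mul_le_mul_of_nonneg_right hlen hχ0))
  -- divide by `β' = Aβ(1 + log β)`
  have hβ'0 : 0 < β' := lt_of_lt_of_le hβ0 hβ'ge
  calc c / A / (β ^ 2 * (1 + Real.log β)) = c / β / β' := by rw [hβ']; field_simp
    _ ≤ β' * χ γ₀ / β' := div_le_div_of_nonneg_right hkey hβ'0.le
    _ = χ γ₀ := by field_simp

/-- **Compact simple gauge groups: the integrated zero-momentum floor** (no dimension hypothesis). [folklore] -/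
theorem exists_integral_sum_torusCov_dens_ge_of_simple (hG : IsCompactSimpleLieGroup G) :
    ∃ c A β₀ : ℝ, 0 < c ∧ 1 ≤ A ∧ 1 ≤ β₀ ∧ ∀ (L : ℕ), 2 ≤ L → ∀ β : ℝ, β₀ ≤ β → ∀ x : Fin 4 → ℤ,
      c / β ≤ ∫ γ in β..(A * β * (1 + Real.log β)), ∑ z ∈ box 4 L,
        (torusE G r γ L (fun U => dens G r x U * dens G r z U) - torusE G r γ L (dens G r x) * torusE G r γ L (dens G r z)) :=
  exists_integral_sum_torusCov_dens_ge G r (dimE_pos_of_isCompactSimpleLieGroup G r hG)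

/-- **Compact simple gauge groups: the zero-momentum two-point floor on every coupling window** (no dimension
hypothesis). [folklore] -/
theorem exists_sum_torusCov_dens_ge_window_of_simple (hG : IsCompactSimpleLieGroup G) :
    ∃ c A β₀ : ℝ, 0 < c ∧ 1 ≤ A ∧ 1 ≤ β₀ ∧ ∀ (L : ℕ), 2 ≤ L → ∀ β : ℝ, β₀ ≤ β → ∀ x : Fin 4 → ℤ,
      ∃ γ ∈ Set.Icc β (A * β * (1 + Real.log β)),
        c / (β ^ 2 * (1 + Real.log β)) ≤ ∑ z ∈ box 4 L,
          (torusE G r γ L (fun U => dens G r x U * dens G r z U) - torusE G r γ L (dens G r x) * torusE G r γ L (dens G r z)) :=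
  exists_sum_torusCov_dens_ge_window G r (dimE_pos_of_isCompactSimpleLieGroup G r hG)

end Window

end Summit.QuantumFields.YangMills.Cruxes.NT.LinkEquipartition

end
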